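import Summits.QuantumFields.QCD.Theses.SpectralDefectExtinction

/-!
# RestateProbe (lead a2, 2026-08-17) — the POLYGROWTH restate of `WindowExtinction` / `ExtinctionBuildsQCD` is a composition-safe,
# junk-neutral, one-clause change, and it makes the line's class stub P `id`

Crux stmt-QuantumFields-18064 `ExtinctionBuildsQCD` (`∀ N_f ∈ {2,3}, SD⁺(N_f) → THR(N_f)`), sibling hinge stmt-18063 `WindowExtinction`
(`∀ N_f ∈ {2,3}, SD⁺(N_f)`).  The registered skeleton of line `determinant-tilt` (`Lines/determinant_tilt.lean`, v5) carries ONE class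
stub P `stub_polyGrowthWitness : SD⁺(N_f) → ∃ witness ∈ SD⁺(N_f) ∧ POLYGROWTH`, POLYGROWTH := `∃ q > 0, ∀ᶠ k, a_k^{-q} ≤ a_k L_k`
(TRIAGE-r1-3 O1 asked for GROWTH `a_kL_k/Z_k → ∞`; the kinematic Kotecký–Preiss rate needs the polynomial form, card
determinant-tilt-kinematic-sign O1; Disproof §10c(1) recommends the restate).  This probe records, kernel-checked and sorry-free:

* `SDPlusPoly` — the restated hypothesis (SD⁺ verbatim ∧ POLYGROWTH), compile-checked text for `route edit`;
* `closes_after_restate` — with BOTH 18063 and 18064 restated, the route's deciding theorem is still composition: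
  `(∀ N_f ∈ {2,3}, SD⁺_poly N_f) → (∀ N_f ∈ {2,3}, SD⁺_poly N_f → THR N_f) → ChiralDescent → QCD`;
* `restated_of_filed` — the restated bridge is IMPLIED by the filed one (it only shrinks the hypothesis class), so every landed
  `--supports stmt-QuantumFields-18064` file (27 + this session's L R S1 T A) keeps serving it verbatim;
* `polyGrowthWitness_after_restate` — under the restated hypothesis the class stub P is a repackaging (`id` in content);
* `canonicalAF_polyGrowth` — the disprover's junk witness `canonicalAF` (`a_k = 1/(k+1)`, `L_k = (k+1)²`) MEETS POLYGROWTH with `q = 1`: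
  by the landed schema `Negative.bridgePlus_collapse_schema` (p135995) / `VolumeGrowth.bridge_collapse_schema_with_growth` (p154859)
  POLYGROWTH is therefore NOT junk-excluding — TIGHT⁺ stays the only junk-excluder, nothing in the load-bearing analysis changes —
  and it costs the honest witness nothing (`L_k = ⌈a_k^{-1-q}⌉` sits inside CAP).
Recommendation to the tenure planner: restate 18063/18064 JOINTLY with `SDPlusPoly` (text below); then P := `fun Nf _ h => h`-trivial and
the registered skeleton needs no other change.
-/

noncomputable section

namespace Summit.QuantumFields.QCD.Cruxes.ExtinctionBuildsQCD.DeterminantTilt.RestateProbe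

open scoped BigOperators Topology Classical MeasureTheory Matrix
open Filter MeasureTheory Matrix
open Literature.MathematicalPhysics.QuantumLattice Literature.MathematicalPhysics.QuantumFieldTheory
  Literature.Probability.LatticeModels
open Summit.QuantumFields.QCD.Theses.SpectralDefectExtinction

/-- POLYGROWTH of a regularisation: the physical torus side is at least a power of the inverse spacing, eventually. [folklore] -/
def PolyGrowth {Nf : ℕ} (reg : QCDRegularisation Nf) : Prop :=
  ∃ q : ℝ, 0 < q ∧ ∀ᶠ k : ℕ in atTop, (reg.a k)⁻¹ ^ q ≤ reg.a k * (reg.L k : ℝ)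

/-- The RESTATED hypothesis `SD⁺_poly(N_f)`: the body of `WindowExtinction` at `N_f` VERBATIM, with POLYGROWTH conjoined after BRANCH
(proposed text for `route edit` of stmt-18063; the bridge stmt-18064 takes the same text as antecedent). [folklore] -/
def SDPlusPoly (Nf : ℕ) : Prop :=
  ∃ reg : QCDRegularisation Nf, PolyGrowth reg ∧ reg.HasMassScaling ∧ (reg.scheme 0 0 0).HasAsymptoticScaling ∧
    (∃ p : ℕ, ∀ᶠ k : ℕ in Filter.atTop, (reg.L k : ℝ) ≤ (reg.a k)⁻¹ ^ p) ∧ (∀ᶠ k : ℕ in Filter.atTop, -1 < reg.mcrit k) ∧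
    ∃ M₀ : ℝ, 0 ≤ M₀ ∧ ∃ c : ℝ, 0 < c ∧ ∀ m : Fin Nf → ℝ, (∀ f, M₀ < m f) →
      (∀ ε : ℝ, 0 < ε → ∀ᶠ k : ℕ in Filter.atTop, ∀ S : ℕ, reg.L k ≤ S → (∫ U, ((∑ f : Fin Nf, ((Multiset.countP (fun z : ℂ => z.im = 0 ∧ z.re < -(reg.mcrit k + reg.a k * m f / reg.Zm k)) (wilsonDirac (fundamentalRep (Fin 3)) U 0 1).charpoly.roots : ℝ) + (Multiset.countP (fun z : ℂ => |z.re| < c * (reg.a k * m f / reg.Zm k)) (spinorLift gammaFive * wilsonDirac (fundamentalRep (Fin 3)) U (reg.mcrit k + reg.a k * m f / reg.Zm k) 1).charpoly.roots : ℝ)))) * ∏ f : Fin Nf, ‖fermionDet (wilsonDirac (fundamentalRep (Fin 3)) U (reg.mcrit k + reg.a k * m f / reg.Zm k) 1)‖ ∂(wilsonMeasure (d := 4) (L := 2 * S + 1) (fundamentalRep (Fin 3)) (reg.β k))) / (∫ U, ∏ f : Fin Nf, ‖fermionDet (wilsonDirac (fundamentalRep (Fin 3)) U (reg.mcrit k +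 reg.a k * m f / reg.Zm k) 1)‖ ∂(wilsonMeasure (d := 4) (L := 2 * S + 1) (fundamentalRep (Fin 3)) (reg.β k))) ≤ ε * ((2 * S + 1 : ℝ) / (2 * reg.L k + 1)) ^ 4) ∧
      (∃ η : ℝ, 0 < η ∧ ∀ M : ℝ, M₀ < M → ∀ᶠ k : ℕ in Filter.atTop, max 1 (η * (reg.a k * (2 * reg.L k + 1 : ℝ)) ^ 2) ≤ (∫ U, (|(Multiset.countP (fun z : ℂ => z.re < 0) (spinorLift gammaFive * wilsonDirac (fundamentalRep (Fin 3)) U (reg.mcrit k - reg.a k * M / reg.Zm k) 1).charpoly.roots : ℝ) - 6 * (2 * reg.L k + 1 : ℝ) ^ 4|) * ∏ f : Fin Nf, ‖fermionDet (wilsonDirac (fundamentalRep (Fin 3)) U (reg.mcrit k + reg.a k * m f / reg.Zm k) 1)‖ ∂(wilsonMeasure (d := 4) (L := 2 * reg.L k + 1) (fundamentalRep (Fin 3)) (reg.β k))) / (∫ U, ∏ f : Fin Nf, ‖fermionDet (wilsonDirac (fundamentalRep (Fin 3)) U (reg.mcrit k + reg.a k * m f / reg.Zm k) 1)‖ ∂(wilsonMeasure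 (d := 4) (L := 2 * reg.L k + 1) (fundamentalRep (Fin 3)) (reg.β k))))

/-- The threshold body THR(N_f) (conclusion of the bridge, antecedent of `ChiralDescent`; verbatim). [folklore] -/
def Threshold (Nf : ℕ) : Prop :=
  (∃ reg : QCDRegularisation Nf, reg.HasMassScaling ∧ ∃ M₁ : ℝ, 0 ≤ M₁ ∧ ∀ m : Fin Nf → ℝ, (∀ f, M₁ < m f) → ∃ (z shift : QCDField Nf → ℕ → ℝ) (T : OSData (QCDField Nf) 4), IsQCDAlong (reg.scheme m z shift) T ∧ T.IsNontrivial QCDField.glue ∧ T.IsNonGaussian QCDField.glue ∧ (∀ f g : Fin Nf, f ≠ g → T.IsNontrivial (QCDField.pseudoRe f g)) ∧ ∃ Δ > 0, T.HasMassGap Δ ∧ (reg.scheme m z shift).HasLatticeMassGap Δ)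

/-- **Composition survives the joint restate**: restated hinge + restated bridge + `ChiralDescent` still give the summit conjunct,
by the same two-line composition as the route's `closes`. -/
theorem closes_after_restate
    (hinge : ∀ Nf : ℕ, (Nf = 2 ∨ Nf = 3) → SDPlusPoly Nf)
    (bridge : ∀ Nf : ℕ, (Nf = 2 ∨ Nf = 3) → SDPlusPoly Nf → Threshold Nf)
    (hC : ChiralDescent) : _root_.QCD :=
  ⟨hC 2 (Or.inl rfl) (bridge 2 (Or.inl rfl) (hinge 2 (Or.inl rfl))),
    hC 3 (Or.inr rfl) (bridge 3 (Or.inr rfl) (hinge 3 (Or.inr rfl)))⟩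

/-- **The restated bridge is implied by the filed one** (it only shrinks the hypothesis class): every landed support of
stmt-18064 keeps serving after the restate. -/
theorem restated_of_filed (h : ExtinctionBuildsQCD) :
    ∀ Nf : ℕ, (Nf = 2 ∨ Nf = 3) → SDPlusPoly Nf → Threshold Nf := by
  intro Nf hNf hSD
  obtain ⟨reg, -, hrest⟩ := hSD
  exact h Nf hNf ⟨reg, hrest⟩

/-- **After the restate the class stub P is a repackaging**: the conclusion of the registered `stub_polyGrowthWitness` (witness data
∧ POLYGROWTH) follows from `SD⁺_poly(N_f)` by reshuffling the conjunction. -/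
theorem polyGrowthWitness_after_restate (Nf : ℕ) (h : SDPlusPoly Nf) :
    ∃ (reg : QCDRegularisation Nf) (M₀ c : ℝ), 0 ≤ M₀ ∧ 0 < c ∧
      reg.HasMassScaling ∧ (reg.scheme 0 0 0).HasAsymptoticScaling ∧
      (∃ p : ℕ, ∀ᶠ k in atTop, (reg.L k : ℝ) ≤ (reg.a k)⁻¹ ^ p) ∧ (∀ᶠ k in atTop, -1 < reg.mcrit k) ∧
      (∀ m : Fin Nf → ℝ, (∀ f, M₀ < m f) →
        (∀ ε : ℝ, 0 < ε → ∀ᶠ k : ℕ in Filter.atTop, ∀ S : ℕ, reg.L k ≤ S → (∫ U, ((∑ f : Fin Nf, ((Multiset.countP (fun z : ℂ => z.im = 0 ∧ z.re < -(reg.mcrit k + reg.a k * m f / reg.Zm k)) (wilsonDirac (fundamentalRep (Fin 3)) U 0 1).charpoly.roots : ℝ) + (Multiset.countP (fun z : ℂ => |z.re| < c * (reg.a k * m f / reg.Zm k)) (spinorLift gammaFive * wilsonDirac (fundamentalRep (Fin 3)) U (reg.mcrit k + reg.a k * m f / reg.Zm k) 1).charpoly.roots : ℝ)))) * ∏ f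 : Fin Nf, ‖fermionDet (wilsonDirac (fundamentalRep (Fin 3)) U (reg.mcrit k + reg.a k * m f / reg.Zm k) 1)‖ ∂(wilsonMeasure (d := 4) (L := 2 * S + 1) (fundamentalRep (Fin 3)) (reg.β k))) / (∫ U, ∏ f : Fin Nf, ‖fermionDet (wilsonDirac (fundamentalRep (Fin 3)) U (reg.mcrit k + reg.a k * m f / reg.Zm k) 1)‖ ∂(wilsonMeasure (d := 4) (L := 2 * S + 1) (fundamentalRep (Fin 3)) (reg.β k))) ≤ ε * ((2 * S + 1 : ℝ) / (2 * reg.L k + 1)) ^ 4) ∧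
        (∃ η : ℝ, 0 < η ∧ ∀ M : ℝ, M₀ < M → ∀ᶠ k : ℕ in Filter.atTop, max 1 (η * (reg.a k * (2 * reg.L k + 1 : ℝ)) ^ 2) ≤ (∫ U, (|(Multiset.countP (fun z : ℂ => z.re < 0) (spinorLift gammaFive * wilsonDirac (fundamentalRep (Fin 3)) U (reg.mcrit k - reg.a k * M / reg.Zm k) 1).charpoly.roots : ℝ) - 6 * (2 * reg.L k + 1 : ℝ) ^ 4|) * ∏ f : Fin Nf, ‖fermionDet (wilsonDirac (fundamentalRep (Fin 3)) U (reg.mcrit k + reg.a k * m f / reg.Zm k) 1)‖ ∂(wilsonMeasure (d := 4) (L := 2 * reg.L k + 1) (fundamentalRep (Fin 3)) (reg.β k))) / (∫ U, ∏ f : Fin Nf, ‖fermionDet (wilsonDirac (fundamentalRep (Fin 3)) U (reg.mcrit k + reg.a k * m f / reg.Zm k) 1)‖ ∂(wilsonMeasure (d := 4) (L := 2 * reg.L k + 1) (fundamentalRep (Fin 3)) (reg.β k))))) ∧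
      (∃ q : ℝ, 0 < q ∧ ∀ᶠ k in atTop, (reg.a k)⁻¹ ^ q ≤ reg.a k * (reg.L k : ℝ)) := by
  obtain ⟨reg, hpoly, hms, has, hcap, hbr, M₀, hM₀, c, hc, hbody⟩ := h
  exact ⟨reg, M₀, c, hM₀, hc, hms, has, hcap, hbr, hbody, hpoly⟩

/-- **The junk witness meets POLYGROWTH** (`canonicalAF`: `a_k = 1/(k+1)`, `L_k = (k+1)²`, so `a_k L_k = k+1 = a_k⁻¹`: `q = 1` with
equality). With `Negative.sdPlusWithoutTight_canonicalAF` (p135995) and the collapse schemas this certifies that POLYGROWTH excludes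
no junk: TIGHT⁺ remains the only junk-excluding clause of the restated class (cf. `Negative.VolumeGrowth` p154859 for GROWTH).
[folklore] -/
theorem canonicalAF_polyGrowth (Nf : ℕ) : PolyGrowth (QCDRegularisation.canonicalAF Nf) := by
  refine ⟨1, one_pos, Filter.Eventually.of_forall fun k => ?_⟩
  have ha : (QCDRegularisation.canonicalAF Nf).a k = ((k : ℝ) + 1)⁻¹ := rfl
  have hL : ((QCDRegularisation.canonicalAF Nf).L k : ℝ) = ((k : ℝ) + 1) ^ 2 := by
    change (((k + 1) ^ 2 : ℕ) : ℝ) = _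
    push_cast
    ring
  rw [Real.rpow_one, ha, hL, inv_inv]
  have hk : (0 : ℝ) < (k : ℝ) + 1 := by positivity
  rw [pow_two, ← mul_assoc, inv_mul_cancel₀ hk.ne', one_mul]

/-- An honest polynomial-volume choice meets POLYGROWTH inside CAP: if `a_k^{-(1+q)} ≤ L_k` eventually (e.g. `L_k = ⌈a_k^{-1-q}⌉`) and
`a_k ≤ 1` eventually, then POLYGROWTH holds with exponent `q`. [folklore] -/
theorem polyGrowth_of_pow_le {Nf : ℕ} (reg : QCDRegularisation Nf) {q : ℝ} (hq : 0 < q)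
    (hL : ∀ᶠ k : ℕ in atTop, (reg.a k)⁻¹ ^ (1 + q) ≤ (reg.L k : ℝ)) : PolyGrowth reg := by
  refine ⟨q, hq, ?_⟩
  filter_upwards [hL] with k hk
  have ha : 0 < reg.a k := reg.a_pos k
  have hsplit : (reg.a k)⁻¹ ^ (1 + q) = (reg.a k)⁻¹ * (reg.a k)⁻¹ ^ q := by
    rw [Real.rpow_add (inv_pos.2 ha), Real.rpow_one]
  rw [hsplit] at hk
  calc (reg.a k)⁻¹ ^ q = reg.a k * ((reg.a k)⁻¹ * (reg.a k)⁻¹ ^ q) := by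
        rw [← mul_assoc, mul_inv_cancel₀ ha.ne', one_mul]
    _ ≤ reg.a k * (reg.L k : ℝ) := mul_le_mul_of_nonneg_left hk ha.le

end Summit.QuantumFields.QCD.Cruxes.ExtinctionBuildsQCD.DeterminantTilt.RestateProbe

end
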